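import Summits.QuantumFields.YangMills.Theses.ParabolicTrajectory

open Literature.MathematicalPhysics.QuantumFieldTheory

noncomputable section

namespace Summit.QuantumFields.YangMills.Cruxes.LatticeGapOnTrajectory.Sketch

/-- Chart repeller, proved from the `remainder` field of `BalabanBanachStep`:
`g < φ g y` for `0 < g ≤ ρ`, `‖y‖ ≤ ρ`, `ρ = min δ (b / (4C))`. -/
theorem chartRepeller_holds
    (G : Type) [Group G] [TopologicalSpace G] [IsTopologicalGroup G] [CompactSpace G]
    [MeasurableSpace G] [BorelSpace G] (r : LatticeRep G) (M : ℕ) (S : BalabanBanachStep G r M) :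
    ∃ ρ : ℝ, 0 < ρ ∧ ρ ≤ S.δ ∧
      ∀ (g : ℝ) (y : S.E), 0 < g → g ≤ ρ → ‖y‖ ≤ ρ → g < S.φ g y := by
  have hb := S.b_pos
  have hC := S.C_pos
  have hδ := S.δ_pos
  refine ⟨min S.δ (S.b / (4 * S.C)), lt_min hδ (by positivity), min_le_left _ _, ?_⟩
  intro g y hg hgρ hyρ
  have hgδ : g ≤ S.δ := hgρ.trans (min_le_left _ _)
  have hyδ : ‖y‖ ≤ S.δ := hyρ.trans (min_le_left _ _)
  have hgb : g ≤ S.b / (4 * S.C) := hgρ.trans (min_le_right _ _)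
  have hyb : ‖y‖ ≤ S.b / (4 * S.C) := hyρ.trans (min_le_right _ _)
  have habs : |g| = g := abs_of_pos hg
  have hrem := (S.remainder g y (by rw [habs]; exact hgδ) hyδ).1
  rw [habs] at hrem
  have hlow : g + S.b * g ^ 3 - S.C * (g ^ 4 + g ^ 3 * ‖y‖) ≤ S.φ g y := by
    have := (abs_le.1 hrem).1
    linarith
  -- C (g + ‖y‖) ≤ b/2
  have hCg : S.C * g ≤ S.b / 4 := by
    have := mul_le_mul_of_nonneg_left hgb hC.le
    calc S.C * g ≤ S.C * (S.b / (4 * S.C)) := this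
      _ = S.b / 4 := by field_simp
  have hCy : S.C * ‖y‖ ≤ S.b / 4 := by
    have := mul_le_mul_of_nonneg_left hyb hC.le
    calc S.C * ‖y‖ ≤ S.C * (S.b / (4 * S.C)) := this
      _ = S.b / 4 := by field_simp
  have hg3 : 0 < g ^ 3 := by positivity
  have key : S.C * (g ^ 4 + g ^ 3 * ‖y‖) ≤ (S.b / 2) * g ^ 3 := by
    have h1 : S.C * (g ^ 4 + g ^ 3 * ‖y‖) = (S.C * g + S.C * ‖y‖) * g ^ 3 := by ring
    rw [h1]
    have h2 : S.C * g + S.C * ‖y‖ ≤ S.b / 2 := by linarith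
    exact mul_le_mul_of_nonneg_right h2 hg3.le
  have : g < g + S.b * g ^ 3 - S.C * (g ^ 4 + g ^ 3 * ‖y‖) := by nlinarith
  exact this.trans_le hlow

end Summit.QuantumFields.YangMills.Cruxes.LatticeGapOnTrajectory.Sketch

end
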